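import Mathlib.Analysis.Calculus.ContDiff.Operations
import Mathlib.Analysis.Calculus.ContDiff.Deriv
import Mathlib.Analysis.Calculus.Deriv.Prod
import Mathlib.Analysis.Calculus.Deriv.Mul
import Mathlib.Analysis.Calculus.Deriv.Add
import Mathlib.Analysis.SpecialFunctions.Trigonometric.Deriv
import Literature.Analysis.FluidPDE.ElgindiSelfSimilarEquations
import HarnessLib

/-!
# Calculus of the slice derivatives `∂_z`, `∂_θ`, `D_z = z∂_z`, `D_θ = sin(2θ)∂_θ` on `Cᵏ`
functions of the open quarter strip

Topic `Literature/Analysis/FluidPDE`. Support file (everything proved, no named facts) of the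
discharge plan of `Literature.Analysis.FluidPDE.Elgindi.ElgindiGhoulMasmoudi2021_stabilityNoSwirl`,
first target the §2.6 datum fact `ElgindiGhoulMasmoudi2021_compactSupportDatum`
(`ElgindiStabilityDecomposition.lean`): the weighted norms `𝓗ᵏ` of Elgindi–Ghoul–Masmoudi
(Camb. J. Math. 9 (2021), §1.7; `ElgindiWeightedSpaces.lean`) are built from the *iterated slice
derivatives* `Elgindi.Dz`, `Elgindi.Dθ` (Mathlib's one-variable `deriv` of the slices
`z' ↦ f z' θ`, `θ' ↦ f z θ'`, junk where the slice is not differentiable), and every estimate on a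
cut-off or perturbed function needs the elementary calculus of these operators *on the open strip*
for functions that are `Cᵏ` there (and arbitrary outside). This file provides it:

* the strip is open; the slice derivatives of a function differentiable at an interior point
  are the Fréchet derivative applied to `(1,0)`, `(0,1)` (`hasDerivAt_slice_fst/snd`,
  `dz_eq_fderiv`, `dθ_eq_fderiv`);
* **regularity**: `∂_z, ∂_θ, D_z, D_θ` map `C^{n+1}(strip)` to `Cⁿ(strip)` (`contDiffOn_dz`, …), and
  the iterates `D_θ^i D_z^j` map `C^N(strip)` to `C^m(strip)` for `i + j + m ≤ N`
  (`contDiffOn_iterate_Dθ_Dz`);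
* **locality**: two functions that agree on the strip have the same `D`-iterates on the strip
  (`iterate_Dθ_Dz_congr`);
* **additivity** on the strip for `C^N` functions, `i + j ≤ N` (`iterate_Dθ_Dz_add`);
* **radial multipliers**: `D_θ` commutes with multiplication by a function of `z` alone
  (globally, `Dθ_radialMul`), and the **Leibniz rule** for `D_z`-iterates of `c(z)f(z,θ)` with the
  one-variable scaling derivative `Dz₁ c = z c'` (`iterate_Dz_radialMul`, binomial form; the radial
  factor is taken `C^N` on all of `ℝ`, which is what smooth cut-offs are), hence
  for the mixed iterates (`iterate_Dθ_Dz_radialMul`).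

Sources: the operators are those of [ElgindiGhoulMasmoudi2021] §1.7 (p. 6 of arXiv:1910.14071);
the content is folklore calculus. Used from Mathlib: `HasFDerivAt.comp_hasDerivAt`,
`ContDiffOn.fderiv_of_isOpen`, `ContDiffOn.clm_apply`, `Filter.EventuallyEq.deriv_eq`,
`HasDerivAt.add/mul/sum`, `Finset.sum_choose_succ_mul` (Pascal's rule for the Leibniz step).
-/

noncomputable section

open Set Function Real Filter Finset
open _root_.Topology

namespace Literature.Analysis.FluidPDE

namespace Elgindi

/-! ### The strip is open; slice derivatives are Fréchet derivatives -/

/-- The open quarter strip is open. [folklore] -/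
theorem isOpen_strip : IsOpen strip :=
  isOpen_Ioi.prod isOpen_Ioo

/-- The strip is a neighbourhood of each of its points. [folklore] -/
theorem strip_mem_nhds {p : ℝ × ℝ} (hp : p ∈ strip) : strip ∈ 𝓝 p :=
  isOpen_strip.mem_nhds hp

/-- The `z`-slice of a function differentiable at `p` has derivative `Df(p)(1,0)`. [folklore] -/
theorem hasDerivAt_slice_fst {g : ℝ × ℝ → ℝ} {p : ℝ × ℝ} (hg : DifferentiableAt ℝ g p) :
    HasDerivAt (fun t => g (t, p.2)) (fderiv ℝ g p (1, 0)) p.1 := by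
  have h1 : HasDerivAt (fun t : ℝ => (t, p.2)) (1, 0) p.1 :=
    (hasDerivAt_id p.1).prodMk (hasDerivAt_const p.1 p.2)
  exact hg.hasFDerivAt.comp_hasDerivAt p.1 h1

/-- The `θ`-slice of a function differentiable at `p` has derivative `Df(p)(0,1)`. [folklore] -/
theorem hasDerivAt_slice_snd {g : ℝ × ℝ → ℝ} {p : ℝ × ℝ} (hg : DifferentiableAt ℝ g p) :
    HasDerivAt (fun t => g (p.1, t)) (fderiv ℝ g p (0, 1)) p.2 := by
  have h1 : HasDerivAt (fun t : ℝ => (p.1, t)) (0, 1) p.2 :=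
    (hasDerivAt_const p.2 p.1).prodMk (hasDerivAt_id p.2)
  exact hg.hasFDerivAt.comp_hasDerivAt p.2 h1

/-- `∂_z f = Df(1,0)` at a point of differentiability. [folklore] -/
theorem dz_eq_fderiv {f : ℝ → ℝ → ℝ} {p : ℝ × ℝ} (hf : DifferentiableAt ℝ (uncurry f) p) :
    dz f p.1 p.2 = fderiv ℝ (uncurry f) p (1, 0) :=
  (hasDerivAt_slice_fst hf).deriv

/-- `∂_θ f = Df(0,1)` at a point of differentiability. [folklore] -/
theorem dθ_eq_fderiv {f : ℝ → ℝ → ℝ} {p : ℝ × ℝ} (hf : DifferentiableAt ℝ (uncurry f) p) :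
    dθ f p.1 p.2 = fderiv ℝ (uncurry f) p (0, 1) :=
  (hasDerivAt_slice_snd hf).deriv

/-- A `Cⁿ` function on the strip, `n ≠ 0`, is differentiable at each point of the strip. [folklore] -/
theorem differentiableAt_of_contDiffOn_strip {g : ℝ × ℝ → ℝ} {n : WithTop ℕ∞}
    (hg : ContDiffOn ℝ n g strip) (hn : n ≠ 0) {p : ℝ × ℝ} (hp : p ∈ strip) :
    DifferentiableAt ℝ g p :=
  (hg.differentiableOn hn p hp).differentiableAt (strip_mem_nhds hp)

/-! ### Regularity: one derivative -/

/-- `∂_z` maps `C^{n+1}(strip)` to `Cⁿ(strip)`. [folklore] -/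
theorem contDiffOn_dz {f : ℝ → ℝ → ℝ} {n : WithTop ℕ∞}
    (hf : ContDiffOn ℝ (n + 1) (uncurry f) strip) : ContDiffOn ℝ n (uncurry (dz f)) strip := by
  have h1 : ContDiffOn ℝ n (fun p => fderiv ℝ (uncurry f) p) strip :=
    hf.fderiv_of_isOpen isOpen_strip le_rfl
  have h2 : ContDiffOn ℝ n (fun p => fderiv ℝ (uncurry f) p (1, 0)) strip :=
    h1.clm_apply contDiffOn_const
  refine h2.congr fun p hp => ?_
  exact dz_eq_fderiv (differentiableAt_of_contDiffOn_strip hf (by simp) hp)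

/-- `∂_θ` maps `C^{n+1}(strip)` to `Cⁿ(strip)`. [folklore] -/
theorem contDiffOn_dθ {f : ℝ → ℝ → ℝ} {n : WithTop ℕ∞}
    (hf : ContDiffOn ℝ (n + 1) (uncurry f) strip) : ContDiffOn ℝ n (uncurry (dθ f)) strip := by
  have h1 : ContDiffOn ℝ n (fun p => fderiv ℝ (uncurry f) p) strip :=
    hf.fderiv_of_isOpen isOpen_strip le_rfl
  have h2 : ContDiffOn ℝ n (fun p => fderiv ℝ (uncurry f) p (0, 1)) strip :=
    h1.clm_apply contDiffOn_const
  refine h2.congr fun p hp => ?_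
  exact dθ_eq_fderiv (differentiableAt_of_contDiffOn_strip hf (by simp) hp)

/-- `D_z = z∂_z` maps `C^{n+1}(strip)` to `Cⁿ(strip)`. [folklore] -/
theorem contDiffOn_Dz {f : ℝ → ℝ → ℝ} {n : WithTop ℕ∞}
    (hf : ContDiffOn ℝ (n + 1) (uncurry f) strip) : ContDiffOn ℝ n (uncurry (Dz f)) strip := by
  have h := (contDiffOn_fst (s := strip)).mul (contDiffOn_dz hf)
  exact h.congr fun p _ => rfl

/-- `D_θ = sin(2θ)∂_θ` maps `C^{n+1}(strip)` to `Cⁿ(strip)`. [folklore] -/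
theorem contDiffOn_Dθ {f : ℝ → ℝ → ℝ} {n : WithTop ℕ∞}
    (hf : ContDiffOn ℝ (n + 1) (uncurry f) strip) : ContDiffOn ℝ n (uncurry (Dθ f)) strip := by
  have hs : ContDiffOn ℝ n (fun p : ℝ × ℝ => Real.sin (2 * p.2)) strip := by fun_prop
  have h := hs.mul (contDiffOn_dθ hf)
  exact h.congr fun p _ => rfl

/-! ### Regularity: iterates -/

/-- `D_z^j` maps `C^N(strip)` to `C^m(strip)` whenever `j + m ≤ N`. [folklore] -/
theorem contDiffOn_iterate_Dz {f : ℝ → ℝ → ℝ} {N : ℕ} (hf : ContDiffOn ℝ N (uncurry f) strip)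
    {j m : ℕ} (h : j + m ≤ N) : ContDiffOn ℝ m (uncurry (Dz^[j] f)) strip := by
  induction j generalizing m with
  | zero =>
    exact hf.of_le (by exact_mod_cast (by omega : m ≤ N))
  | succ j ih =>
    rw [Function.iterate_succ_apply']
    have h1 : ContDiffOn ℝ ((m + 1 : ℕ) : WithTop ℕ∞) (uncurry (Dz^[j] f)) strip := ih (by omega)
    exact contDiffOn_Dz (by exact_mod_cast h1)

/-- `D_θ^i` maps `C^N(strip)` to `C^m(strip)` whenever `i + m ≤ N`. [folklore] -/
theorem contDiffOn_iterate_Dθ {f : ℝ → ℝ → ℝ} {N : ℕ} (hf : ContDiffOn ℝ N (uncurry f) strip)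
    {i m : ℕ} (h : i + m ≤ N) : ContDiffOn ℝ m (uncurry (Dθ^[i] f)) strip := by
  induction i generalizing m with
  | zero =>
    exact hf.of_le (by exact_mod_cast (by omega : m ≤ N))
  | succ i ih =>
    rw [Function.iterate_succ_apply']
    have h1 : ContDiffOn ℝ ((m + 1 : ℕ) : WithTop ℕ∞) (uncurry (Dθ^[i] f)) strip := ih (by omega)
    exact contDiffOn_Dθ (by exact_mod_cast h1)

/-- The mixed iterates `D_θ^i D_z^j` map `C^N(strip)` to `C^m(strip)` whenever `i + j + m ≤ N`. [folklore] -/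
theorem contDiffOn_iterate_Dθ_Dz {f : ℝ → ℝ → ℝ} {N : ℕ} (hf : ContDiffOn ℝ N (uncurry f) strip)
    {i j m : ℕ} (h : i + j + m ≤ N) : ContDiffOn ℝ m (uncurry (Dθ^[i] (Dz^[j] f))) strip :=
  contDiffOn_iterate_Dθ (N := i + m) (contDiffOn_iterate_Dz hf (by omega)) le_rfl

/-- The mixed iterates of a `C^N` function are continuous on the strip (`i + j ≤ N`). [folklore] -/
theorem continuousOn_iterate_Dθ_Dz {f : ℝ → ℝ → ℝ} {N : ℕ} (hf : ContDiffOn ℝ N (uncurry f) strip)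
    {i j : ℕ} (h : i + j ≤ N) : ContinuousOn (uncurry (Dθ^[i] (Dz^[j] f))) strip :=
  (contDiffOn_iterate_Dθ_Dz hf (m := 0) (by omega)).continuousOn

/-! ### Locality: dependence on the values in the strip only -/

/-- If `f = g` on the strip then `∂_z f = ∂_z g` on the strip (the strip is open). [folklore] -/
theorem dz_congr {f g : ℝ → ℝ → ℝ} (h : ∀ p ∈ strip, f p.1 p.2 = g p.1 p.2) {p : ℝ × ℝ}
    (hp : p ∈ strip) : dz f p.1 p.2 = dz g p.1 p.2 := by
  unfold dz
  apply Filter.EventuallyEq.deriv_eq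
  have ht : Tendsto (fun t : ℝ => (t, p.2)) (𝓝 p.1) (𝓝 p) :=
    (continuous_id.prodMk continuous_const).continuousAt
  filter_upwards [ht (strip_mem_nhds hp)] with t hts
  exact h (t, p.2) hts

/-- If `f = g` on the strip then `∂_θ f = ∂_θ g` on the strip. [folklore] -/
theorem dθ_congr {f g : ℝ → ℝ → ℝ} (h : ∀ p ∈ strip, f p.1 p.2 = g p.1 p.2) {p : ℝ × ℝ}
    (hp : p ∈ strip) : dθ f p.1 p.2 = dθ g p.1 p.2 := by
  unfold dθ
  apply Filter.EventuallyEq.deriv_eq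
  have ht : Tendsto (fun t : ℝ => (p.1, t)) (𝓝 p.2) (𝓝 p) :=
    (continuous_const.prodMk continuous_id).continuousAt
  filter_upwards [ht (strip_mem_nhds hp)] with t hts
  exact h (p.1, t) hts

/-- If `f = g` on the strip then `D_z f = D_z g` on the strip. [folklore] -/
theorem Dz_congr {f g : ℝ → ℝ → ℝ} (h : ∀ p ∈ strip, f p.1 p.2 = g p.1 p.2) {p : ℝ × ℝ}
    (hp : p ∈ strip) : Dz f p.1 p.2 = Dz g p.1 p.2 := by
  rw [Dz_eq_mul_dz, Dz_eq_mul_dz, dz_congr h hp]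

/-- If `f = g` on the strip then `D_θ f = D_θ g` on the strip. [folklore] -/
theorem Dθ_congr {f g : ℝ → ℝ → ℝ} (h : ∀ p ∈ strip, f p.1 p.2 = g p.1 p.2) {p : ℝ × ℝ}
    (hp : p ∈ strip) : Dθ f p.1 p.2 = Dθ g p.1 p.2 := by
  rw [Dθ_eq_mul_dθ, Dθ_eq_mul_dθ, dθ_congr h hp]

/-- If `f = g` on the strip then `D_z^j f = D_z^j g` on the strip. [folklore] -/
theorem iterate_Dz_congr {f g : ℝ → ℝ → ℝ} (h : ∀ p ∈ strip, f p.1 p.2 = g p.1 p.2) (j : ℕ) :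
    ∀ p ∈ strip, Dz^[j] f p.1 p.2 = Dz^[j] g p.1 p.2 := by
  induction j with
  | zero => exact h
  | succ j ih =>
    intro p hp
    rw [Function.iterate_succ_apply', Function.iterate_succ_apply']
    exact Dz_congr ih hp

/-- If `f = g` on the strip then `D_θ^i f = D_θ^i g` on the strip. [folklore] -/
theorem iterate_Dθ_congr {f g : ℝ → ℝ → ℝ} (h : ∀ p ∈ strip, f p.1 p.2 = g p.1 p.2) (i : ℕ) :
    ∀ p ∈ strip, Dθ^[i] f p.1 p.2 = Dθ^[i] g p.1 p.2 := by
  induction i with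
  | zero => exact h
  | succ i ih =>
    intro p hp
    rw [Function.iterate_succ_apply', Function.iterate_succ_apply']
    exact Dθ_congr ih hp

/-- If `f = g` on the strip then `D_θ^i D_z^j f = D_θ^i D_z^j g` on the strip. [folklore] -/
theorem iterate_Dθ_Dz_congr {f g : ℝ → ℝ → ℝ} (h : ∀ p ∈ strip, f p.1 p.2 = g p.1 p.2) (i j : ℕ) :
    ∀ p ∈ strip, Dθ^[i] (Dz^[j] f) p.1 p.2 = Dθ^[i] (Dz^[j] g) p.1 p.2 :=
  iterate_Dθ_congr (iterate_Dz_congr h j) i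

/-! ### Additivity on the strip -/

/-- `D_z (f + g) = D_z f + D_z g` at a point where both are jointly differentiable (as functions
of `(z, θ)`). [folklore] -/
theorem Dz_add_apply {f g : ℝ → ℝ → ℝ} {p : ℝ × ℝ} (hf : DifferentiableAt ℝ (uncurry f) p)
    (hg : DifferentiableAt ℝ (uncurry g) p) :
    Dz (f + g) p.1 p.2 = Dz f p.1 p.2 + Dz g p.1 p.2 := by
  have h1 : HasDerivAt (fun z' => f z' p.2) (fderiv ℝ (uncurry f) p (1, 0)) p.1 :=
    hasDerivAt_slice_fst hf
  have h2 : HasDerivAt (fun z' => g z' p.2) (fderiv ℝ (uncurry g) p (1, 0)) p.1 :=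
    hasDerivAt_slice_fst hg
  have h12 : HasDerivAt (fun z' => (f + g) z' p.2)
      (fderiv ℝ (uncurry f) p (1, 0) + fderiv ℝ (uncurry g) p (1, 0)) p.1 := h1.add h2
  simp only [Dz_eq_mul_dz, dz, h1.deriv, h2.deriv, h12.deriv]
  ring

/-- `D_θ (f + g) = D_θ f + D_θ g` at a point where both are jointly differentiable (as functions
of `(z, θ)`). [folklore] -/
theorem Dθ_add_apply {f g : ℝ → ℝ → ℝ} {p : ℝ × ℝ} (hf : DifferentiableAt ℝ (uncurry f) p)
    (hg : DifferentiableAt ℝ (uncurry g) p) :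
    Dθ (f + g) p.1 p.2 = Dθ f p.1 p.2 + Dθ g p.1 p.2 := by
  have h1 : HasDerivAt (fun θ' => f p.1 θ') (fderiv ℝ (uncurry f) p (0, 1)) p.2 :=
    hasDerivAt_slice_snd hf
  have h2 : HasDerivAt (fun θ' => g p.1 θ') (fderiv ℝ (uncurry g) p (0, 1)) p.2 :=
    hasDerivAt_slice_snd hg
  have h12 : HasDerivAt (fun θ' => (f + g) p.1 θ')
      (fderiv ℝ (uncurry f) p (0, 1) + fderiv ℝ (uncurry g) p (0, 1)) p.2 := h1.add h2
  simp only [Dθ_eq_mul_dθ, dθ, h1.deriv, h2.deriv, h12.deriv]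
  ring

/-- **Additivity of `D_z^j` on the strip** for `C^N` functions, `j ≤ N`. [folklore] -/
theorem iterate_Dz_add {f g : ℝ → ℝ → ℝ} {N : ℕ} (hf : ContDiffOn ℝ N (uncurry f) strip)
    (hg : ContDiffOn ℝ N (uncurry g) strip) {j : ℕ} (hj : j ≤ N) :
    ∀ p ∈ strip, Dz^[j] (f + g) p.1 p.2 = Dz^[j] f p.1 p.2 + Dz^[j] g p.1 p.2 := by
  induction j with
  | zero => intro p _; rfl
  | succ j ih =>
    intro p hp
    have ih' := ih (by omega)
    rw [Function.iterate_succ_apply', Function.iterate_succ_apply', Function.iterate_succ_apply']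
    -- replace `D_z^j (f + g)` by `D_z^j f + D_z^j g` near `p`, then differentiate the sum
    have e1 : Dz (Dz^[j] (f + g)) p.1 p.2 = Dz (Dz^[j] f + Dz^[j] g) p.1 p.2 :=
      Dz_congr (fun q hq => by simpa using ih' q hq) hp
    have h1 : ContDiffOn ℝ 1 (uncurry (Dz^[j] f)) strip := contDiffOn_iterate_Dz hf (by omega)
    have h2 : ContDiffOn ℝ 1 (uncurry (Dz^[j] g)) strip := contDiffOn_iterate_Dz hg (by omega)
    rw [e1, Dz_add_apply (differentiableAt_of_contDiffOn_strip h1 one_ne_zero hp)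
      (differentiableAt_of_contDiffOn_strip h2 one_ne_zero hp)]

/-- **Additivity of `D_θ^i` on the strip** for `C^N` functions, `i ≤ N`. [folklore] -/
theorem iterate_Dθ_add {f g : ℝ → ℝ → ℝ} {N : ℕ} (hf : ContDiffOn ℝ N (uncurry f) strip)
    (hg : ContDiffOn ℝ N (uncurry g) strip) {i : ℕ} (hi : i ≤ N) :
    ∀ p ∈ strip, Dθ^[i] (f + g) p.1 p.2 = Dθ^[i] f p.1 p.2 + Dθ^[i] g p.1 p.2 := by
  induction i with
  | zero => intro p _; rfl
  | succ i ih =>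
    intro p hp
    have ih' := ih (by omega)
    rw [Function.iterate_succ_apply', Function.iterate_succ_apply', Function.iterate_succ_apply']
    have e1 : Dθ (Dθ^[i] (f + g)) p.1 p.2 = Dθ (Dθ^[i] f + Dθ^[i] g) p.1 p.2 :=
      Dθ_congr (fun q hq => by simpa using ih' q hq) hp
    have h1 : ContDiffOn ℝ 1 (uncurry (Dθ^[i] f)) strip := contDiffOn_iterate_Dθ hf (by omega)
    have h2 : ContDiffOn ℝ 1 (uncurry (Dθ^[i] g)) strip := contDiffOn_iterate_Dθ hg (by omega)
    rw [e1, Dθ_add_apply (differentiableAt_of_contDiffOn_strip h1 one_ne_zero hp)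
      (differentiableAt_of_contDiffOn_strip h2 one_ne_zero hp)]

/-- **Additivity of the mixed iterates `D_θ^i D_z^j` on the strip** for `C^N` functions,
`i + j ≤ N`. [folklore] -/
theorem iterate_Dθ_Dz_add {f g : ℝ → ℝ → ℝ} {N : ℕ} (hf : ContDiffOn ℝ N (uncurry f) strip)
    (hg : ContDiffOn ℝ N (uncurry g) strip) {i j : ℕ} (h : i + j ≤ N) :
    ∀ p ∈ strip, Dθ^[i] (Dz^[j] (f + g)) p.1 p.2 =
      Dθ^[i] (Dz^[j] f) p.1 p.2 + Dθ^[i] (Dz^[j] g) p.1 p.2 := by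
  intro p hp
  -- `D_z^j (f + g) = D_z^j f + D_z^j g` on the strip, so their `D_θ^i` agree on the strip
  have e1 : Dθ^[i] (Dz^[j] (f + g)) p.1 p.2 = Dθ^[i] (Dz^[j] f + Dz^[j] g) p.1 p.2 :=
    iterate_Dθ_congr (fun q hq => by simpa using iterate_Dz_add hf hg (by omega) q hq) i p hp
  rw [e1]
  exact iterate_Dθ_add (N := i) (contDiffOn_iterate_Dz hf (by omega))
    (contDiffOn_iterate_Dz hg (by omega)) le_rfl p hp

/-- Subtraction form of the additivity: `D_θ^i D_z^j (f − g) = D_θ^i D_z^j f − D_θ^i D_z^j g` on the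
strip (`i + j ≤ N`). [folklore] -/
theorem iterate_Dθ_Dz_sub {f g : ℝ → ℝ → ℝ} {N : ℕ} (hf : ContDiffOn ℝ N (uncurry f) strip)
    (hg : ContDiffOn ℝ N (uncurry g) strip) {i j : ℕ} (h : i + j ≤ N) :
    ∀ p ∈ strip, Dθ^[i] (Dz^[j] (f - g)) p.1 p.2 =
      Dθ^[i] (Dz^[j] f) p.1 p.2 - Dθ^[i] (Dz^[j] g) p.1 p.2 := by
  intro p hp
  have hg' : ContDiffOn ℝ N (uncurry ((-1 : ℝ) • g)) strip := by
    have := hg.const_smul (-1 : ℝ)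
    exact this.congr fun q _ => by simp [uncurry]
  have e : f - g = f + (-1 : ℝ) • g := by
    funext z θ; simp [sub_eq_add_neg]
  rw [e, iterate_Dθ_Dz_add hf hg' h p hp, iterate_Dz_smul, iterate_Dθ_smul]
  simp [sub_eq_add_neg]

/-! ### Radial multipliers: `D_θ` commutes, `D_z` obeys the Leibniz rule -/

/-- Multiplication of `f(z, θ)` by a function `c(z)` of the radial variable alone. [folklore] -/
def radialMul (c : ℝ → ℝ) (f : ℝ → ℝ → ℝ) : ℝ → ℝ → ℝ :=
  fun z θ => c z * f z θ

/-- Unfolding `radialMul`. [folklore] -/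
@[simp] theorem radialMul_apply (c : ℝ → ℝ) (f : ℝ → ℝ → ℝ) (z θ : ℝ) :
    radialMul c f z θ = c z * f z θ := rfl

/-- The one-variable scaling derivative `Dz₁ c = z c'` of a radial function. [folklore] -/
def Dz₁ (c : ℝ → ℝ) : ℝ → ℝ :=
  fun z => z * deriv c z

/-- Unfolding `Dz₁`. [folklore] -/
theorem Dz₁_apply (c : ℝ → ℝ) (z : ℝ) : Dz₁ c z = z * deriv c z := rfl

/-- **`D_θ` commutes with radial multipliers** (globally, no differentiability needed):
`D_θ (c f) = c D_θ f`. [folklore] -/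
theorem Dθ_radialMul (c : ℝ → ℝ) (f : ℝ → ℝ → ℝ) : Dθ (radialMul c f) = radialMul c (Dθ f) := by
  funext z θ
  simp only [Dθ_apply, radialMul_apply, deriv_const_mul_field]
  ring

/-- `D_θ^i (c f) = c D_θ^i f` (globally). [folklore] -/
theorem iterate_Dθ_radialMul (c : ℝ → ℝ) (f : ℝ → ℝ → ℝ) (i : ℕ) :
    Dθ^[i] (radialMul c f) = radialMul c (Dθ^[i] f) := by
  induction i with
  | zero => rfl
  | succ i ih => rw [Function.iterate_succ_apply', Function.iterate_succ_apply', ih, Dθ_radialMul]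

/-- **Leibniz rule for `D_z`** at a point: `D_z (c f) = (Dz₁ c) f + c D_z f` where `c` is
differentiable at `z` and `f` is jointly differentiable at `(z, θ)`. [folklore] -/
theorem Dz_radialMul_apply {c : ℝ → ℝ} {f : ℝ → ℝ → ℝ} {p : ℝ × ℝ} (hc : DifferentiableAt ℝ c p.1)
    (hf : DifferentiableAt ℝ (uncurry f) p) :
    Dz (radialMul c f) p.1 p.2 = Dz₁ c p.1 * f p.1 p.2 + c p.1 * Dz f p.1 p.2 := by
  have h1 : HasDerivAt (fun z' => f z' p.2) (fderiv ℝ (uncurry f) p (1, 0)) p.1 :=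
    hasDerivAt_slice_fst hf
  have h2 : HasDerivAt (fun z' => radialMul c f z' p.2)
      (deriv c p.1 * f p.1 p.2 + c p.1 * fderiv ℝ (uncurry f) p (1, 0)) p.1 :=
    hc.hasDerivAt.mul h1
  simp only [Dz_eq_mul_dz, dz, Dz₁_apply, h1.deriv, h2.deriv]
  ring

/-- A radial function `c ∈ C^{n+1}` has `Dz₁ c ∈ Cⁿ` (on all of `ℝ`). [folklore] -/
theorem contDiff_Dz₁ {c : ℝ → ℝ} {n : WithTop ℕ∞} (hc : ContDiff ℝ (n + 1) c) :
    ContDiff ℝ n (Dz₁ c) := by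
  unfold Dz₁
  exact contDiff_id.mul hc.deriv'

/-- Iterates: `c ∈ C^N` has `Dz₁^l c ∈ C^m` for `l + m ≤ N`. [folklore] -/
theorem contDiff_iterate_Dz₁ {c : ℝ → ℝ} {N : ℕ} (hc : ContDiff ℝ N c) {l m : ℕ} (h : l + m ≤ N) :
    ContDiff ℝ m (Dz₁^[l] c) := by
  induction l generalizing m with
  | zero => exact hc.of_le (by exact_mod_cast (by omega : m ≤ N))
  | succ l ih =>
    rw [Function.iterate_succ_apply']
    have h1 : ContDiff ℝ ((m + 1 : ℕ) : WithTop ℕ∞) (Dz₁^[l] c) := ih (by omega)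
    exact contDiff_Dz₁ (by exact_mod_cast h1)

/-- A radial multiplier `c ∈ C^N(ℝ)` keeps `C^N(strip)`: `c f ∈ C^N(strip)`. [folklore] -/
theorem contDiffOn_radialMul {c : ℝ → ℝ} {f : ℝ → ℝ → ℝ} {n : WithTop ℕ∞} (hc : ContDiff ℝ n c)
    (hf : ContDiffOn ℝ n (uncurry f) strip) : ContDiffOn ℝ n (uncurry (radialMul c f)) strip := by
  have h := ((hc.comp contDiff_fst).contDiffOn (s := strip)).mul hf
  exact h.congr fun p _ => rfl

/-- **The binomial Leibniz formula for `D_z^j (c f)` on the strip**: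
`D_z^j (c f) = ∑_{l ≤ j} (j choose l) (Dz₁^l c) (D_z^{j−l} f)` for `c ∈ C^N(ℝ)`, `f ∈ C^N(strip)`,
`j ≤ N`. [folklore] -/
theorem iterate_Dz_radialMul {c : ℝ → ℝ} {f : ℝ → ℝ → ℝ} {N : ℕ} (hc : ContDiff ℝ N c)
    (hf : ContDiffOn ℝ N (uncurry f) strip) {j : ℕ} (hj : j ≤ N) :
    ∀ p ∈ strip, Dz^[j] (radialMul c f) p.1 p.2 =
      ∑ l ∈ range (j + 1), (j.choose l : ℝ) * (Dz₁^[l] c p.1 * Dz^[j - l] f p.1 p.2) := by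
  induction j with
  | zero => intro p _; simp
  | succ j ih =>
    intro p hp
    have ih' := ih (by omega)
    -- the right-hand side at level `j`, as a function, is a sum of radial products
    set G : ℝ → ℝ → ℝ := fun z θ =>
      ∑ l ∈ range (j + 1), (j.choose l : ℝ) * (Dz₁^[l] c z * Dz^[j - l] f z θ) with hG
    have eG : ∀ q ∈ strip, Dz^[j] (radialMul c f) q.1 q.2 = G q.1 q.2 := fun q hq => ih' q hq
    rw [Function.iterate_succ_apply', Dz_congr eG hp]
    -- differentiate the sum term by term: each term is `(j choose l) • radialMul (Dz₁^l c) (Dz^{j-l} f)`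
    have hterm : ∀ l ∈ range (j + 1),
        HasDerivAt (fun z' => (j.choose l : ℝ) * (Dz₁^[l] c z' * Dz^[j - l] f z' p.2))
          ((j.choose l : ℝ) * (deriv (Dz₁^[l] c) p.1 * Dz^[j - l] f p.1 p.2 +
            Dz₁^[l] c p.1 * dz (Dz^[j - l] f) p.1 p.2)) p.1 := by
      intro l hl
      have hl' : l ≤ j := Nat.lt_succ_iff.mp (mem_range.mp hl)
      have hcl : ContDiff ℝ 1 (Dz₁^[l] c) := contDiff_iterate_Dz₁ hc (by omega)
      have hcd : HasDerivAt (Dz₁^[l] c) (deriv (Dz₁^[l] c) p.1) p.1 :=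
        ((hcl.differentiable one_ne_zero) p.1).hasDerivAt
      have hfl : ContDiffOn ℝ 1 (uncurry (Dz^[j - l] f)) strip :=
        contDiffOn_iterate_Dz hf (by omega)
      have hfd : HasDerivAt (fun z' => Dz^[j - l] f z' p.2) (dz (Dz^[j - l] f) p.1 p.2) p.1 := by
        have := hasDerivAt_slice_fst (differentiableAt_of_contDiffOn_strip hfl one_ne_zero hp)
        rwa [← dz_eq_fderiv (differentiableAt_of_contDiffOn_strip hfl one_ne_zero hp)] at this
      exact (hcd.mul hfd).const_mul _
    have hsum : HasDerivAt (fun z' => G z' p.2)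
        (∑ l ∈ range (j + 1), (j.choose l : ℝ) * (deriv (Dz₁^[l] c) p.1 * Dz^[j - l] f p.1 p.2 +
            Dz₁^[l] c p.1 * dz (Dz^[j - l] f) p.1 p.2)) p.1 := by
      have := HasDerivAt.sum hterm
      refine this.congr_of_eventuallyEq (Eventually.of_forall fun z' => ?_)
      simp [hG, Finset.sum_apply]
    rw [Dz_eq_mul_dz, dz, hsum.deriv]
    -- now the algebra: `z (a_l' b + a_l b') = a_{l+1} b + a_l b_{+1}`, then Pascal's rule
    simp only [Finset.mul_sum]
    have key : ∀ l ∈ range (j + 1),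
        p.1 * ((j.choose l : ℝ) * (deriv (Dz₁^[l] c) p.1 * Dz^[j - l] f p.1 p.2 +
          Dz₁^[l] c p.1 * dz (Dz^[j - l] f) p.1 p.2)) =
        (j.choose l : ℝ) * (Dz₁^[l + 1] c p.1 * Dz^[j - l] f p.1 p.2) +
          (j.choose l : ℝ) * (Dz₁^[l] c p.1 * Dz^[j + 1 - l] f p.1 p.2) := by
      intro l hl
      have hl' : l ≤ j := Nat.lt_succ_iff.mp (mem_range.mp hl)
      have e : j + 1 - l = (j - l) + 1 := by omega
      rw [e, Function.iterate_succ_apply', Function.iterate_succ_apply', Dz₁_apply, Dz_eq_mul_dz]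
      ring
    rw [Finset.sum_congr rfl key, Finset.sum_add_distrib]
    rw [Finset.sum_choose_succ_mul (fun l m => Dz₁^[l] c p.1 * Dz^[m] f p.1 p.2) j, add_comm]

/-! ### Finite sums and the mixed Leibniz formula -/

/-- A finite sum of `C^N(strip)` functions (curried) is `C^N(strip)`. [folklore] -/
theorem contDiffOn_finset_sum {ι : Type*} (s : Finset ι) {F : ι → ℝ → ℝ → ℝ} {n : WithTop ℕ∞}
    (hF : ∀ k ∈ s, ContDiffOn ℝ n (uncurry (F k)) strip) :
    ContDiffOn ℝ n (uncurry (∑ k ∈ s, F k)) strip := by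
  have h := ContDiffOn.sum (fun k hk => hF k hk)
  refine h.congr fun p _ => ?_
  simp [uncurry, Finset.sum_apply]

/-- **`D_θ^i` of a finite sum** of `C^N(strip)` functions on the strip (`i ≤ N`). [folklore] -/
theorem iterate_Dθ_finset_sum {ι : Type*} (s : Finset ι) {F : ι → ℝ → ℝ → ℝ} {N : ℕ}
    (hF : ∀ k ∈ s, ContDiffOn ℝ N (uncurry (F k)) strip) {i : ℕ} (hi : i ≤ N) :
    ∀ p ∈ strip, Dθ^[i] (∑ k ∈ s, F k) p.1 p.2 = ∑ k ∈ s, Dθ^[i] (F k) p.1 p.2 := by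
  classical
  induction s using Finset.induction_on with
  | empty =>
    intro p _
    simp [iterate_Dθ_zero]
  | insert a s ha ih =>
    intro p hp
    have hFs : ∀ k ∈ s, ContDiffOn ℝ N (uncurry (F k)) strip :=
      fun k hk => hF k (Finset.mem_insert_of_mem hk)
    rw [Finset.sum_insert ha, Finset.sum_insert ha,
      iterate_Dθ_add (hF a (Finset.mem_insert_self a s)) (contDiffOn_finset_sum s hFs) hi p hp,
      ih hFs p hp]

/-- **The Leibniz formula for the mixed iterates of a radial product on the strip**:
`D_θ^i D_z^j (c f) = ∑_{l ≤ j} (j choose l) (Dz₁^l c) · D_θ^i D_z^{j−l} f` for `c ∈ C^N(ℝ)`,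
`f ∈ C^N(strip)`, `i + j ≤ N` (`D_θ` passes through the radial factors). [folklore] -/
theorem iterate_Dθ_Dz_radialMul {c : ℝ → ℝ} {f : ℝ → ℝ → ℝ} {N : ℕ} (hc : ContDiff ℝ N c)
    (hf : ContDiffOn ℝ N (uncurry f) strip) {i j : ℕ} (h : i + j ≤ N) :
    ∀ p ∈ strip, Dθ^[i] (Dz^[j] (radialMul c f)) p.1 p.2 =
      ∑ l ∈ range (j + 1), (j.choose l : ℝ) * (Dz₁^[l] c p.1 * Dθ^[i] (Dz^[j - l] f) p.1 p.2) := by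
  intro p hp
  -- the summands of the `D_z`-Leibniz formula, as functions
  set G : ℕ → ℝ → ℝ → ℝ := fun l =>
    radialMul (fun z => (j.choose l : ℝ) * Dz₁^[l] c z) (Dz^[j - l] f) with hG
  have eG : ∀ q ∈ strip, Dz^[j] (radialMul c f) q.1 q.2 = (∑ l ∈ range (j + 1), G l) q.1 q.2 := by
    intro q hq
    rw [iterate_Dz_radialMul hc hf (by omega) q hq]
    simp [hG, Finset.sum_apply, mul_assoc]
  have hGl : ∀ l ∈ range (j + 1), ContDiffOn ℝ (i : ℕ) (uncurry (G l)) strip := by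
    intro l hl
    have hl' : l ≤ j := Nat.lt_succ_iff.mp (mem_range.mp hl)
    have hcl : ContDiff ℝ (i : ℕ) (fun z => (j.choose l : ℝ) * Dz₁^[l] c z) :=
      contDiff_const.mul (contDiff_iterate_Dz₁ hc (by omega))
    exact contDiffOn_radialMul hcl (contDiffOn_iterate_Dz hf (by omega))
  rw [iterate_Dθ_congr eG i p hp, iterate_Dθ_finset_sum _ hGl le_rfl p hp]
  refine Finset.sum_congr rfl fun l _ => ?_
  rw [hG, iterate_Dθ_radialMul]
  simp [mul_assoc]

end Elgindi

end Literature.Analysis.FluidPDE
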